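import Literature.MathematicalPhysics.QuantumFieldTheory.Balaban1983to89.B8Ineq159FlatCubeMemberKernel
import Literature.MathematicalPhysics.QuantumFieldTheory.Balaban1983to89.B8Ineq159FlatCubeMemberTransplant
import Literature.MathematicalPhysics.QuantumFieldTheory.Balaban1983to89.B8Ineq159FlatMaps

/-!
# `Balaban1983to89.B8Ineq159FlatCubeMemberCstar` — [Balaban1985RegularSpaces] (1.59) p. 86 AT `U₀ = 1` ON THE CUBE MEMBER `{□_j}` OF (1.131), FOR
# `𝔤`-VALUED (here: `𝔸`-valued) BOND FUNCTIONS — «⊗ identity» ([Balaban1985BackgroundPropagators] p. 394) IN THE NAMED-FACT CURRENCY: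
# the kernel certificate and dag-n05-c's PROVED named fact `Ineq159FlatCubeMemberPrinted` transferred from `ℂ`-valued to `𝔸`-valued fields,
# with print's constant; unconditional for `d ≥ 2`, odd `L ≥ 5`

statement-level skeleton of published theorems with citation tags; proofs where landed; nothing here is a claim about the
Yang–Mills mass gap

`[Balaban1985RegularSpaces]` ("B8", CMP **99** (1985) 75–102) (1.59) p. 86, (1.62) p. 87, (1.31) p. 82, (1.38) p. 82, (1.131) p. 99;
`[Balaban1985BackgroundPropagators]` ("[4]", CMP **99** (1985) 389–434) Thm 3.3 p. 399, p. 394 («the operators … act on functions with values in the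
algebra … they are of the form … ⊗ identity»); `[Balaban1984PropagatorsII]` ("B6", CMP **96** (1984) 223–250) (2.11) p. 225, Prop. 2.6 p. 247.
PDF held: `paper:balaban1985-cmp99-regular-spaces-gauge-fixing` (journal page = PDF page + 74).

CITATION HEADER (lean-in-tree rule).  Cell `pub-ymgap` (YM Track A, HUMAN RULING D-0062 ∕ D-0149), DAG node N05 = [B8], width seat
`pub-ymgap-dag-n05-w3` (g2), CLAIM-1 file (A) (bus 2026-08-28 01:57Z).  WHY.  The flat (1.59) at the cube member is in the tree in TWO forms, both for
`ℂ`-VALUED (abelian, scalar) bond functions: the kernel certificate `B8Ineq159FlatCubeMemberKernel.eq_zero_of_ineq159FlatData_eq_zero` (this seat g0,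
p583885: the repaired flat data over print's class `cubeLamBP` determine the field) and the named fact `B8Ineq159FlatCubeMemberPrinted.Ineq159FlatCubeMemberPrinted`
(dag-n05-c, p573921) PROVED by the transplant `B8Ineq159FlatCubeMemberTransplant.ineq159FlatCubeMemberPrinted_holds` (dag-n05-c T4) for every dimension and
every odd `L ≥ 5`.  The gauge fields of the programme are `𝔸`-valued (`𝔸 = M₂(ℂ)` at the record); [4] p. 394 treats the passage as the convention «⊗ identity».
dag-n05-e's `B8Ineq159FlatOfScalar.flat159_clause_of_scalar` performs it in THEOREM 4's `H59₁` currency (weighted suprema, `W = e^{iηA′}`, `u`, `mgauge`); THIS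
FILE performs it in the NAMED-FACT currency (pointwise, print's (1.62) form, averaging datum over print's class, outer-layer allowance), which is the currency the
per-member CURVED perturbation files of this seat's CLAIM-1 start from.

THE MATHEMATICS (kernel-checked).  For a continuous functional `f ∈ 𝔸*` the scalar field `a_f := f ∘ φ` inherits every hypothesis: the flat Landau condition
(1.38) (`B8Ineq159FlatMaps.isLandau138_map_flat`, multiplier `f ∘ μ`), the support, and — since at `U₀ = 1` the current `J = D^{η*}_1D^η_1`, the covariant
derivative, the Laplacian and the linearised averages `Q_j(1)` are finite `ℂ`-linear stencils (`map_Jcur_flat`, `map_covDerivFwd_flat`, `map_covLap_flat`,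
`map_linCovIter_flat`) — the data bounds with `N ↦ ‖f‖·N` (resp. the vanishing of the data).  The scalar theorems then give `a_f = 0` (resp. the three pointwise
bounds for `a_f` with `B₀·‖f‖·N`), and Hahn–Banach (`NormedSpace.norm_le_dual_bound`) returns the statement for `φ` with the SAME `B₀`.
* §0 (private) boundedness of a bond function bounded off the touching bonds; `map_iEta`.
* §1 ★ `eq_zero_of_ineq159FlatData_eq_zero_cstar` — the kernel certificate for `𝔸`-valued `φ` ([B6] (2.11) at the member, «⊗ id»).
* §2 ★★ `ineq159FlatCubeMember_cstar_of_printed` — the body of `Ineq159FlatCubeMemberPrinted d L` with `ℂ ↦ 𝔸`, same constants, from the named fact.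
* §3 ★★ `ineq159FlatCubeMember_cstar_holds` — unconditional for `d ≥ 2` (as `d + 1`), odd `L ≥ 5` (as `ℓ + 1`), by dag-n05-c's transplant.

HONEST SCOPE.  Functional analysis bookkeeping («⊗ id») on top of PROVED tree theorems; no new estimate; the background is FLAT (`U₀ = 1`) — nothing here
is the curved (1.59) ∕ [4] Thm 3.3 at a general small field (files (B)–(D) of CLAIM-1 are the per-member perturbation; the uniform curved estimate is N06's
object layer).  Count-neutral; N05 NOT discharged; no count claim; one finite `𝕋⁴` programme at fixed `ε`, Bałaban as printed; the YM mass gap (Clay) is NOT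
proved by any of this — R4 closes the conditional finite-`𝕋⁴` rung `BalabanLadder.UV` only; nothing continuum ∕ ℝ⁴ ∕ OS.  No `sorry`, no `def`, no
`instance`, no `notation`.  Unit `pub-ymgap-dag-n05-w3` (g2), 2026-08-28.
-/

noncomputable section

namespace Literature.MathematicalPhysics.QuantumFieldTheory.Balaban1983to89.B8Ineq159FlatCubeMemberCstar

open NormedSpace
open B7Prop1Explicit B7Prop2Explicit B7Prop1Local
open B7Prop4GeneralLevels (linCovIter)
open B8Ineq132 (covDerivFwd BondTouches)
open B8Eq146AExpansion (iEta)
open B8Eq155JBound (Jcur)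
open B8Eq138LandauZd (IsLandau138 covLap)
open B8Eq140Level (SideTouches)
open B8Eq131Cubes (cube sqLo sqHi)
open B8Eq131CubesAdmissible (cubeFam cubeFam_false_zero)
open B8CubeMemberZd (cubeLamS)
open B8Ineq159FlatCubeMemberPrinted (cubeLamBP Ineq159FlatCubeMemberPrinted)
open B8Ineq159FlatCubeMemberKernel (eq_zero_of_ineq159FlatData_eq_zero)
open B8Ineq159FlatCubeMemberTransplant (ineq159FlatCubeMemberPrinted_holds)
open B8Eq191FlatLettersCubeMember (inBox_finite)
open B8Ineq159FlatMaps (map_covDerivFwd_flat map_Jcur_flat map_covLap_flat isLandau138_map_flat map_linCovIter_flat)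

export B7Prop1Explicit (Site)

variable {d : ℕ}

variable {𝔸 : Type*} [NormedRing 𝔸] [NormOneClass 𝔸] [NormedAlgebra ℂ 𝔸] [CompleteSpace 𝔸]

/-! ## §0 Bookkeeping: a bond function supported on the bonds touching `□₀` is bounded; `f ∘ (iηφ) = iη(f ∘ φ)` -/

omit [NormOneClass 𝔸] [NormedAlgebra ℂ 𝔸] [CompleteSpace 𝔸] in
/-- A bond function bounded off the bonds touching the finite cube `□₀` is bounded (finitely many other values) — private plumbing. [folklore] -/
private theorem exists_norm_le_of_bound_off_cube (L : ℕ) (a : Site d) (M ρ k : ℕ) {φ : Site d → Fin d → 𝔸} {c : ℝ}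
    (hout : ∀ (y : Site d) (τ : Fin d), ¬ BondTouches (cubeFam false L a M ρ k 0) y τ → ‖φ y τ‖ ≤ c) :
    ∃ b : ℝ, 0 ≤ b ∧ ∀ (z : Site d) (κ : Fin d), ‖φ z κ‖ ≤ b := by
  classical
  set lo : Site d := sqLo L a ρ k 0 with hlo
  set hi : Site d := sqHi L a M ρ k 0 with hhi
  have hΩ0 : cubeFam false L a M ρ k 0 = {y | InBox lo hi y} := by rw [cubeFam_false_zero]; rfl
  -- every touching bond starts in the finite box `[lo − 1, hi]`
  have hT : ({x : Site d | InBox (lo - 1) hi x}).Finite := inBox_finite (lo - 1) hi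
  have hfar : ∀ (z : Site d) (κ : Fin d), ¬ InBox (lo - 1) hi z → ‖φ z κ‖ ≤ c := by
    intro z κ hz
    refine hout z κ fun hbt => hz ?_
    rw [hΩ0] at hbt
    intro i
    rcases hbt with h | h
    · have := h i; simp only [Pi.sub_apply, Pi.one_apply]; omega
    · have := h i
      rw [add_e_apply] at this
      simp only [Pi.sub_apply, Pi.one_apply]
      split_ifs at this <;> omega
  refine ⟨(∑ z ∈ hT.toFinset, ∑ κ : Fin d, ‖φ z κ‖) + |c|, by positivity, fun z κ => ?_⟩
  by_cases hz : InBox (lo - 1) hi z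
  · have hzT : z ∈ hT.toFinset := by rw [Set.Finite.mem_toFinset]; exact hz
    calc ‖φ z κ‖ ≤ ∑ κ' : Fin d, ‖φ z κ'‖ :=
          Finset.single_le_sum (f := fun κ' => ‖φ z κ'‖) (fun _ _ => norm_nonneg _) (Finset.mem_univ κ)
      _ ≤ ∑ z' ∈ hT.toFinset, ∑ κ' : Fin d, ‖φ z' κ'‖ :=
          Finset.single_le_sum (f := fun z' => ∑ κ' : Fin d, ‖φ z' κ'‖) (fun _ _ => by positivity) hzT
      _ ≤ (∑ z' ∈ hT.toFinset, ∑ κ' : Fin d, ‖φ z' κ'‖) + |c| := le_add_of_nonneg_right (abs_nonneg c)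
  · calc ‖φ z κ‖ ≤ c := hfar z κ hz
      _ ≤ |c| := le_abs_self c
      _ ≤ (∑ z' ∈ hT.toFinset, ∑ κ' : Fin d, ‖φ z' κ'‖) + |c| := le_add_of_nonneg_left (by positivity)

omit [NormOneClass 𝔸] [CompleteSpace 𝔸] in
/-- `f ∘ (iηφ) = iη·(f ∘ φ)` for a `ℂ`-linear functional — the exponent field (1.41) under «⊗ identity».
[cite: Balaban1985BackgroundPropagators, p.394; Balaban1985RegularSpaces, (1.41) p.83] -/
theorem map_iEta (f : StrongDual ℂ 𝔸) (η : ℝ) (φ : Site d → Fin d → 𝔸) :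
    (fun w ν => f (iEta η φ w ν)) = iEta η (fun y τ => f (φ y τ)) := by
  funext w ν
  simp only [iEta, map_smul, smul_eq_mul]

/-! ## §1 The kernel certificate for `𝔸`-valued bond functions -/

/-- ★ **THE REPAIRED FLAT (1.59) DATA DETERMINE AN `𝔸`-VALUED FIELD — KERNEL ZERO AT EVERY CUBE MEMBER, «⊗ identity».**  Let `d ≥ 2`, `L ≥ 1`, `η > 0`,
a cube datum `(a, M, ρ, k)` of (1.131), a truncation `1 ≤ m ≤ k`, and an `𝔸`-valued bond function `φ` (`𝔸` any complete normed `ℂ`-algebra) such that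
(1) `φ` is in the flat Landau gauge of record `IsLandau138 L m η □₀ (cubeLamS … m) 1 φ` ((1.38), multiplier form); (2) `φ` vanishes off the bonds touching
`□₀`; (3) the current `J = D^{η*}_1D^η_1φ` vanishes on the bonds touching `□₀`; (4) the un-normalised flat averages `Lʲη·Q_j(1)(iηφ)` vanish on every bond
of print's class `cubeLamBP … m j`, `j ≤ m`.  Then `φ = 0`.  PROOF: for every `f ∈ 𝔸*`, `f ∘ φ` is a scalar field with the same four properties (the flat
stencils commute with `f`, `B8Ineq159FlatMaps`), so `f ∘ φ = 0` by the scalar certificate `eq_zero_of_ineq159FlatData_eq_zero` (g0); Hahn–Banach.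
[cite: Balaban1985RegularSpaces, (1.59) p.86, (1.38) p.82, (1.31) p.82, (1.131) p.99; Balaban1985BackgroundPropagators, Thm 3.3 p.399, p.394; Balaban1984PropagatorsII, (2.11) p.225] -/
theorem eq_zero_of_ineq159FlatData_eq_zero_cstar (hd2 : 2 ≤ d) {L : ℕ} (hL : 1 ≤ L) {η : ℝ} (hη : 0 < η) (a : Site d) (M ρ : ℕ)
    {k m : ℕ} (hm1 : 1 ≤ m) (hmk : m ≤ k) {φ : Site d → Fin d → 𝔸}
    (hLan : IsLandau138 L m η (cubeFam false L a M ρ k 0) (cubeLamS L a M ρ k m) (1 : Site d → Fin d → 𝔸ˣ) φ)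
    (hsupp : ∀ (y : Site d) (τ : Fin d), ¬ BondTouches (cubeFam false L a M ρ k 0) y τ → φ y τ = 0)
    (hJ : ∀ (y : Site d) (τ : Fin d), BondTouches (cubeFam false L a M ρ k 0) y τ →
      Jcur η (1 : Site d → Fin d → 𝔸ˣ) φ τ y = 0)
    (hdata : ∀ j, j ≤ m → ∀ c ∈ cubeLamBP L a M ρ k m j,
      linCovIter L (1 : Site d → Fin d → 𝔸ˣ) (iEta η φ) j c.1 c.2 = 0) :
    φ = 0 := by
  obtain ⟨b, hb0, hb⟩ := exists_norm_le_of_bound_off_cube L a M ρ k (φ := φ) (c := 0)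
    (fun y τ h => by rw [hsupp y τ h, norm_zero])
  have hiEta : ∀ (y : Site d) (κ : Fin d), ‖iEta η φ y κ‖ ≤ η * b := fun y κ =>
    B8Eq146AExpansion.norm_iEta_le hη.le hb y κ
  funext y τ
  refine SeparatingDual.eq_zero_of_forall_dual_eq_zero (R := ℂ) fun f => ?_
  -- the scalar field `a_f = f ∘ φ` has the four properties
  have hLanf : IsLandau138 L m η (cubeFam false L a M ρ k 0) (cubeLamS L a M ρ k m) (1 : Site d → Fin d → ℂˣ)
      (fun y τ => f (φ y τ)) := isLandau138_map_flat f hLan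
  have hsuppf : ∀ (y : Site d) (τ : Fin d), ¬ BondTouches (cubeFam false L a M ρ k 0) y τ → f (φ y τ) = 0 :=
    fun y' τ' h => by rw [hsupp y' τ' h, map_zero]
  have hJf : ∀ (y : Site d) (τ : Fin d), BondTouches (cubeFam false L a M ρ k 0) y τ →
      Jcur η (1 : Site d → Fin d → ℂˣ) (fun y τ => f (φ y τ)) τ y = 0 := by
    intro y' τ' h
    rw [← map_Jcur_flat f η φ τ' y', hJ y' τ' h, map_zero]
  have hdataf : ∀ j, j ≤ m → ∀ c ∈ cubeLamBP L a M ρ k m j,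
      linCovIter L (1 : Site d → Fin d → ℂˣ) (iEta η (fun y τ => f (φ y τ))) j c.1 c.2 = 0 := by
    intro j hj c hc
    rw [← map_iEta f η φ, ← map_linCovIter_flat f hL (iEta η φ) (by positivity) hiEta j c.1 c.2, hdata j hj c hc, map_zero]
  have key := eq_zero_of_ineq159FlatData_eq_zero hd2 hL hη a M ρ hm1 hmk hLanf hsuppf hJf hdataf
  have := congrFun (congrFun key y) τ
  simpa using this

/-! ## §2 The named fact's body for `𝔸`-valued bond functions, from the named fact -/

/-- ★★ **(1.59) AT `U₀ = 1` ON THE CUBE MEMBER, AVERAGING DATUM OVER PRINT'S CLASS, FOR `𝔸`-VALUED BOND FUNCTIONS — from the scalar named fact with the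
SAME constant.**  If `Ineq159FlatCubeMemberPrinted d L` holds (dag-n05-c's named fact: `B₀ > 0` and thresholds `ρ₀, M₀, N₀, R₀` for `ℂ`-valued `φ`), then with the
SAME `B₀, ρ₀, M₀, N₀, R₀`: for every `η > 0`, every cube datum on print's p. 98 sub-lattice above threshold, every truncation `1 ≤ m ≤ k` and every `𝔸`-VALUED
bond function `φ` in the flat Landau gauge (1.38) supported on the bonds touching `□₀`, if `N ≥ 0` bounds (i) `(Lʲη)³|J_1(φ)|` on the bonds of `□_j`, (ii) the
flat averages `|Lʲη·Q_j(1)(iηφ)(c)|` on print's class `cubeLamBP … m j`, (iii) `η|φ|` on the outer layer, then on every bond side-touching `□_j`: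
`(Lʲη)|φ| ≤ B₀N`, `(Lʲη)²|D^η_{1,ν}φ_τ| ≤ B₀N`, `(Lʲη)³|Δ^η_1φ_τ| ≤ B₀N`.  PROOF: for `f ∈ 𝔸*` the scalar field `f ∘ φ` satisfies (i)–(iii) with `‖f‖·N`
(flat stencils commute with `f`), so the named fact bounds `f` of the three left members by `B₀‖f‖N`; Hahn–Banach (`NormedSpace.norm_le_dual_bound`).
[cite: Balaban1985RegularSpaces, (1.59) p.86, (1.62) p.87, (1.31) p.82, (1.38) p.82, (1.131)–(1.132) p.99, p.98; Balaban1985BackgroundPropagators, Thm 3.3 p.399, p.394; Balaban1984PropagatorsII, Prop. 2.6 (2.136) p.247] -/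
theorem ineq159FlatCubeMember_cstar_of_printed {L : ℕ} (hL : 1 ≤ L) (hP : Ineq159FlatCubeMemberPrinted d L) :
    ∃ B₀ ρ₀ M₀ : ℝ, ∃ N₀ R₀ : ℕ, 0 < B₀ ∧
    ∀ (η : ℝ), 0 < η → ∀ (a : Site d) (M ρ k s R : ℕ), 1 ≤ k →
      M₀ ≤ (L : ℝ) ^ (s + 1) → L ^ (s + 1) ∣ ρ → L ^ (s + 1) ∣ M → R * L ^ (s + 1) ≤ ρ → R₀ ≤ R →
      N₀ + 1 ≤ R * L ^ (s + 1) → ρ₀ ≤ (ρ : ℝ) →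
      ∀ m, 1 ≤ m → m ≤ k → ∀ φ : Site d → Fin d → 𝔸,
        IsLandau138 L m η (cubeFam false L a M ρ k 0) (cubeLamS L a M ρ k m) (1 : Site d → Fin d → 𝔸ˣ) φ →
        (∀ (y : Site d) (τ : Fin d), (∀ j, j ≤ m → ¬ SideTouches (cubeFam false L a M ρ k j) y τ) → φ y τ = 0) →
        ∀ N : ℝ, 0 ≤ N →
          (∀ j, j ≤ m → ∀ (y : Site d) (τ : Fin d), BondTouches (cubeFam false L a M ρ k j) y τ →
              ((L : ℝ) ^ j * η) ^ 3 * ‖Jcur η (1 : Site d → Fin d → 𝔸ˣ) φ τ y‖ ≤ N) →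
          (∀ j, j ≤ m → ∀ c ∈ cubeLamBP L a M ρ k m j,
              ‖linCovIter L (1 : Site d → Fin d → 𝔸ˣ) (iEta η φ) j c.1 c.2‖ ≤ N) →
          (∀ (y : Site d) (τ : Fin d), ¬ BondTouches (cubeFam false L a M ρ k 0) y τ → η * ‖φ y τ‖ ≤ N) →
          ∀ j, j ≤ m → ∀ (y : Site d) (τ : Fin d), SideTouches (cubeFam false L a M ρ k j) y τ →
            ((L : ℝ) ^ j * η) * ‖φ y τ‖ ≤ B₀ * N ∧
            (∀ ν : Fin d, ((L : ℝ) ^ j * η) ^ 2 * ‖covDerivFwd η (1 : Site d → Fin d → 𝔸ˣ) ν (fun z => φ z τ) y‖ ≤ B₀ * N) ∧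
            ((L : ℝ) ^ j * η) ^ 3 * ‖covLap η (1 : Site d → Fin d → 𝔸ˣ) (fun z => φ z τ) y‖ ≤ B₀ * N := by
  obtain ⟨B₀, ρ₀, M₀, N₀, R₀, hB₀, H⟩ := hP
  refine ⟨B₀, ρ₀, M₀, N₀, R₀, hB₀, ?_⟩
  intro η hη a M ρ k s R hk hM₀ hρdvd hMdvd hRρ hR₀ hN₀ hρ₀ m hm1 hmk φ hLan hsupp N hN hJ hQ hout j hj y τ hyτ
  have hL0 : (0 : ℝ) < L := by exact_mod_cast hL
  have hw : 0 < (L : ℝ) ^ j * η := by positivity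
  -- `φ` is bounded: by `N/η` off the touching bonds (hypothesis (iii)), finitely many values on them — needed only to commute `f` with `Q_j(1)`
  obtain ⟨b, hb0, hb⟩ := exists_norm_le_of_bound_off_cube L a M ρ k (φ := φ) (c := η⁻¹ * N) (fun y' τ' h => by
    rw [inv_mul_eq_div, le_div_iff₀ hη, mul_comm]; exact hout y' τ' h)
  have hiEta : ∀ (y : Site d) (κ : Fin d), ‖iEta η φ y κ‖ ≤ η * b := fun y κ =>
    B8Eq146AExpansion.norm_iEta_le hη.le hb y κ
  -- the scalar statement for `f ∘ φ`, every `f ∈ 𝔸*`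
  have key : ∀ f : StrongDual ℂ 𝔸,
      ((L : ℝ) ^ j * η) * ‖f (φ y τ)‖ ≤ B₀ * (‖f‖ * N) ∧
      (∀ ν : Fin d, ((L : ℝ) ^ j * η) ^ 2 *
        ‖covDerivFwd η (1 : Site d → Fin d → ℂˣ) ν (fun z => f (φ z τ)) y‖ ≤ B₀ * (‖f‖ * N)) ∧
      ((L : ℝ) ^ j * η) ^ 3 * ‖covLap η (1 : Site d → Fin d → ℂˣ) (fun z => f (φ z τ)) y‖ ≤ B₀ * (‖f‖ * N) := by
    intro f
    refine H η hη a M ρ k s R hk hM₀ hρdvd hMdvd hRρ hR₀ hN₀ hρ₀ m hm1 hmk (fun y τ => f (φ y τ)) (isLandau138_map_flat f hLan)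
      (fun y' τ' h => by rw [hsupp y' τ' h, map_zero]) (‖f‖ * N) (by positivity) ?_ ?_ ?_ j hj y τ hyτ
    · intro j' hj' y' τ' hbt
      rw [← map_Jcur_flat f η φ τ' y']
      calc ((L : ℝ) ^ j' * η) ^ 3 * ‖f (Jcur η (1 : Site d → Fin d → 𝔸ˣ) φ τ' y')‖
          ≤ ((L : ℝ) ^ j' * η) ^ 3 * (‖f‖ * ‖Jcur η (1 : Site d → Fin d → 𝔸ˣ) φ τ' y'‖) :=
            mul_le_mul_of_nonneg_left (f.le_opNorm _) (by positivity)
        _ = ‖f‖ * (((L : ℝ) ^ j' * η) ^ 3 * ‖Jcur η (1 : Site d → Fin d → 𝔸ˣ) φ τ' y'‖) := by ring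
        _ ≤ ‖f‖ * N := mul_le_mul_of_nonneg_left (hJ j' hj' y' τ' hbt) (norm_nonneg _)
    · intro j' hj' c hc
      rw [← map_iEta f η φ, ← map_linCovIter_flat f hL (iEta η φ) (by positivity) hiEta j' c.1 c.2]
      exact (f.le_opNorm _).trans (mul_le_mul_of_nonneg_left (hQ j' hj' c hc) (norm_nonneg _))
    · intro y' τ' h
      calc η * ‖f (φ y' τ')‖ ≤ η * (‖f‖ * ‖φ y' τ'‖) := mul_le_mul_of_nonneg_left (f.le_opNorm _) hη.le
        _ = ‖f‖ * (η * ‖φ y' τ'‖) := by ring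
        _ ≤ ‖f‖ * N := mul_le_mul_of_nonneg_left (hout y' τ' h) (norm_nonneg _)
  -- Hahn–Banach on each of the three members
  refine ⟨?_, fun ν => ?_, ?_⟩
  · have hdual : ‖φ y τ‖ ≤ B₀ * N * ((L : ℝ) ^ j * η)⁻¹ := by
      refine NormedSpace.norm_le_dual_bound ℂ _ (by positivity) fun f => ?_
      have h1 := (key f).1
      rw [mul_comm] at h1
      calc ‖f (φ y τ)‖ = ‖f (φ y τ)‖ * ((L : ℝ) ^ j * η) * ((L : ℝ) ^ j * η)⁻¹ := by field_simp
        _ ≤ B₀ * (‖f‖ * N) * ((L : ℝ) ^ j * η)⁻¹ := mul_le_mul_of_nonneg_right h1 (by positivity)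
        _ = B₀ * N * ((L : ℝ) ^ j * η)⁻¹ * ‖f‖ := by ring
    calc (L : ℝ) ^ j * η * ‖φ y τ‖ ≤ (L : ℝ) ^ j * η * (B₀ * N * ((L : ℝ) ^ j * η)⁻¹) :=
          mul_le_mul_of_nonneg_left hdual hw.le
      _ = B₀ * N := by field_simp
  · have hD : ∀ f : StrongDual ℂ 𝔸, covDerivFwd η (1 : Site d → Fin d → ℂˣ) ν (fun z => f (φ z τ)) y =
        f (covDerivFwd η (1 : Site d → Fin d → 𝔸ˣ) ν (fun z => φ z τ) y) := fun f =>
      (map_covDerivFwd_flat f η ν (fun z => φ z τ) y).symm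
    have hdual : ‖covDerivFwd η (1 : Site d → Fin d → 𝔸ˣ) ν (fun z => φ z τ) y‖ ≤ B₀ * N * (((L : ℝ) ^ j * η) ^ 2)⁻¹ := by
      refine NormedSpace.norm_le_dual_bound ℂ _ (by positivity) fun f => ?_
      have h1 := (key f).2.1 ν
      rw [hD f, mul_comm] at h1
      calc ‖f (covDerivFwd η (1 : Site d → Fin d → 𝔸ˣ) ν (fun z => φ z τ) y)‖
          = ‖f (covDerivFwd η (1 : Site d → Fin d → 𝔸ˣ) ν (fun z => φ z τ) y)‖ * ((L : ℝ) ^ j * η) ^ 2 *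
              (((L : ℝ) ^ j * η) ^ 2)⁻¹ := by field_simp
        _ ≤ B₀ * (‖f‖ * N) * (((L : ℝ) ^ j * η) ^ 2)⁻¹ := mul_le_mul_of_nonneg_right h1 (by positivity)
        _ = B₀ * N * (((L : ℝ) ^ j * η) ^ 2)⁻¹ * ‖f‖ := by ring
    calc ((L : ℝ) ^ j * η) ^ 2 * ‖covDerivFwd η (1 : Site d → Fin d → 𝔸ˣ) ν (fun z => φ z τ) y‖
        ≤ ((L : ℝ) ^ j * η) ^ 2 * (B₀ * N * (((L : ℝ) ^ j * η) ^ 2)⁻¹) := mul_le_mul_of_nonneg_left hdual (by positivity)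
      _ = B₀ * N := by field_simp
  · have hΔ : ∀ f : StrongDual ℂ 𝔸, covLap η (1 : Site d → Fin d → ℂˣ) (fun z => f (φ z τ)) y =
        f (covLap η (1 : Site d → Fin d → 𝔸ˣ) (fun z => φ z τ) y) := fun f =>
      (map_covLap_flat f η (fun z => φ z τ) y).symm
    have hdual : ‖covLap η (1 : Site d → Fin d → 𝔸ˣ) (fun z => φ z τ) y‖ ≤ B₀ * N * (((L : ℝ) ^ j * η) ^ 3)⁻¹ := by
      refine NormedSpace.norm_le_dual_bound ℂ _ (by positivity) fun f => ?_
      have h1 := (key f).2.2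
      rw [hΔ f, mul_comm] at h1
      calc ‖f (covLap η (1 : Site d → Fin d → 𝔸ˣ) (fun z => φ z τ) y)‖
          = ‖f (covLap η (1 : Site d → Fin d → 𝔸ˣ) (fun z => φ z τ) y)‖ * ((L : ℝ) ^ j * η) ^ 3 *
              (((L : ℝ) ^ j * η) ^ 3)⁻¹ := by field_simp
        _ ≤ B₀ * (‖f‖ * N) * (((L : ℝ) ^ j * η) ^ 3)⁻¹ := mul_le_mul_of_nonneg_right h1 (by positivity)
        _ = B₀ * N * (((L : ℝ) ^ j * η) ^ 3)⁻¹ * ‖f‖ := by ring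
    calc ((L : ℝ) ^ j * η) ^ 3 * ‖covLap η (1 : Site d → Fin d → 𝔸ˣ) (fun z => φ z τ) y‖
        ≤ ((L : ℝ) ^ j * η) ^ 3 * (B₀ * N * (((L : ℝ) ^ j * η) ^ 3)⁻¹) := mul_le_mul_of_nonneg_left hdual (by positivity)
      _ = B₀ * N := by field_simp

/-! ## §3 Unconditional: `d ≥ 2`, odd `L ≥ 5` (dag-n05-c's transplant) -/

/-- ★★ **(1.59) AT `U₀ = 1` ON THE CUBE MEMBER FOR `𝔸`-VALUED BOND FUNCTIONS — UNCONDITIONAL for every dimension `d + 1 ≥ 2`… (here `d + 1`, any `d`) and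
every odd `L = ℓ + 1 ≥ 5`**: §2 at dag-n05-c's PROVED named fact `ineq159FlatCubeMemberPrinted_holds d ℓ` (transplant T4 of lit-balaban's torus-with-level-0
Proposition 3).  Print's «R₁, M₁ the smallest integers for which [2, 4] hold» are the thresholds; `L` odd `≥ 5` is the transplant's parametrisation.
[cite: Balaban1985RegularSpaces, (1.59) p.86, (1.62) p.87, (1.131) p.99, p.98; Balaban1985BackgroundPropagators, Thm 3.3 p.399, p.394; Balaban1984PropagatorsII, Prop. 2.6 (2.136) p.247] -/
theorem ineq159FlatCubeMember_cstar_holds (d ℓ : ℕ) (hℓ : 4 ≤ ℓ) (hodd : Odd (ℓ + 1)) :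
    ∃ B₀ ρ₀ M₀ : ℝ, ∃ N₀ R₀ : ℕ, 0 < B₀ ∧
    ∀ (η : ℝ), 0 < η → ∀ (a : Site (d + 1)) (M ρ k s R : ℕ), 1 ≤ k →
      M₀ ≤ ((ℓ + 1 : ℕ) : ℝ) ^ (s + 1) → (ℓ + 1) ^ (s + 1) ∣ ρ → (ℓ + 1) ^ (s + 1) ∣ M → R * (ℓ + 1) ^ (s + 1) ≤ ρ → R₀ ≤ R →
      N₀ + 1 ≤ R * (ℓ + 1) ^ (s + 1) → ρ₀ ≤ (ρ : ℝ) →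
      ∀ m, 1 ≤ m → m ≤ k → ∀ φ : Site (d + 1) → Fin (d + 1) → 𝔸,
        IsLandau138 (ℓ + 1) m η (cubeFam false (ℓ + 1) a M ρ k 0) (cubeLamS (ℓ + 1) a M ρ k m)
          (1 : Site (d + 1) → Fin (d + 1) → 𝔸ˣ) φ →
        (∀ (y : Site (d + 1)) (τ : Fin (d + 1)), (∀ j, j ≤ m → ¬ SideTouches (cubeFam false (ℓ + 1) a M ρ k j) y τ) → φ y τ = 0) →
        ∀ N : ℝ, 0 ≤ N →
          (∀ j, j ≤ m → ∀ (y : Site (d + 1)) (τ : Fin (d + 1)), BondTouches (cubeFam false (ℓ + 1) a M ρ k j) y τ →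
              (((ℓ + 1 : ℕ) : ℝ) ^ j * η) ^ 3 * ‖Jcur η (1 : Site (d + 1) → Fin (d + 1) → 𝔸ˣ) φ τ y‖ ≤ N) →
          (∀ j, j ≤ m → ∀ c ∈ cubeLamBP (ℓ + 1) a M ρ k m j,
              ‖linCovIter (ℓ + 1) (1 : Site (d + 1) → Fin (d + 1) → 𝔸ˣ) (iEta η φ) j c.1 c.2‖ ≤ N) →
          (∀ (y : Site (d + 1)) (τ : Fin (d + 1)), ¬ BondTouches (cubeFam false (ℓ + 1) a M ρ k 0) y τ → η * ‖φ y τ‖ ≤ N) →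
          ∀ j, j ≤ m → ∀ (y : Site (d + 1)) (τ : Fin (d + 1)), SideTouches (cubeFam false (ℓ + 1) a M ρ k j) y τ →
            (((ℓ + 1 : ℕ) : ℝ) ^ j * η) * ‖φ y τ‖ ≤ B₀ * N ∧
            (∀ ν : Fin (d + 1), (((ℓ + 1 : ℕ) : ℝ) ^ j * η) ^ 2 *
              ‖covDerivFwd η (1 : Site (d + 1) → Fin (d + 1) → 𝔸ˣ) ν (fun z => φ z τ) y‖ ≤ B₀ * N) ∧
            (((ℓ + 1 : ℕ) : ℝ) ^ j * η) ^ 3 * ‖covLap η (1 : Site (d + 1) → Fin (d + 1) → 𝔸ˣ) (fun z => φ z τ) y‖ ≤ B₀ * N :=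
  ineq159FlatCubeMember_cstar_of_printed (by omega) (ineq159FlatCubeMemberPrinted_holds d ℓ hℓ hodd)

#print axioms eq_zero_of_ineq159FlatData_eq_zero_cstar
#print axioms ineq159FlatCubeMember_cstar_of_printed
#print axioms ineq159FlatCubeMember_cstar_holds

end Literature.MathematicalPhysics.QuantumFieldTheory.Balaban1983to89.B8Ineq159FlatCubeMemberCstar

end
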